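import Summits.HodgeConjecture.HodgeConjecture.Theorems.CyclicUnitaryPowersEigenDualBasis
import Summits.HodgeConjecture.HodgeConjecture.Theorems.CyclicUnitaryPowersDeckUnitaryGroup
import Literature.RepresentationTheory.ClassicalInvariants.TensorFFTLetterColoured
import Literature.AlgebraicGeometry.Motives.MumfordTateInvariantsTensorBasis

/-!
# The deck-unitary group in the adapted basis: tensor coordinates, block elements, and the word model of the
# coloured GL first fundamental theorem

Helper for stub L `stub_deckUnitaryInvariantsMatching` of the crux `PowersHodgeOfDeckCommutators`
(stmt-HodgeConjecture-19545, route `CyclicUnitaryPowers`, line `unitary-kunneth-fft` v6, lane 2).  With the adapted basis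
`f` of `CyclicUnitaryPowersEigenDualBasis` (letters `Option (Fin h × Bool × Fin n)`: `none ↦ x₀ ∈ E_0`, vector letters
`(i, false, a) ↦ e_{i,a} ∈ E_{i+1}`, covector letters `(i, true, a) ↦ e^{i,a} ∈ E_{p-(i+1)}`, `B (e_{i,a}) (e^{i,a'}) = δ`):

* §1 tensor coordinates `tcoord f x w` of `x ∈ T^{r,0}_K W` in the tensor basis `⊗_q f (w q)` and the action of
  `γ ∈ GL(W)` in coordinates: `tcoord f (γ x) w' = Σ_w (Π_q [γ]_f (w' q) (w q)) tcoord f x w`;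
* §2 the BLOCK ELEMENTS `glElem i g ∈ U⁰(K)` (`g ∈ GL_n(K)` on `E_{i+1}` in the basis `e_{i,·}`, its `B`-contragredient
  `(g⁻¹)ᵀ` on `E_{p-(i+1)}` in the dual basis `e^{i,·}`, identity on the other blocks —
  `CyclicUnitaryPowersBlockExtension.ext`) and their matrix in `f`;
The sequel `CyclicUnitaryPowersPatternWords` turns this into the word model of Goodman–Wallach Thm. 5.3.1 coloured.

Pure linear algebra; no Hodge theory.
-/

noncomputable section

open Module Matrix
open scoped TensorProduct PiTensorProduct BigOperators

namespace Summit.HodgeConjecture.HodgeConjecture.Theorems.CyclicUnitaryPowersBlockAction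

open Literature.AlgebraicGeometry.Motives
open Literature.RepresentationTheory.GeneralLinear (wordRepAt wordRepAt_apply wordRepAt_mul wordRepAt_one)
open Literature.RepresentationTheory.ClassicalInvariants (mixedFamily mixedFamily_of_eq_true mixedFamily_of_eq_false)
open Summit.HodgeConjecture.HodgeConjecture.Theorems.CyclicUnitaryPowersSpectralProjectors
open Summit.HodgeConjecture.HodgeConjecture.Theorems.CyclicUnitaryPowersEigenPairing
open Summit.HodgeConjecture.HodgeConjecture.Theorems.CyclicUnitaryPowersBlockExtension
open Summit.HodgeConjecture.HodgeConjecture.Theorems.CyclicUnitaryPowersDeckUnitaryGroup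
open Summit.HodgeConjecture.HodgeConjecture.Theorems.CyclicUnitaryPowersEigenDualBasis

variable {K : Type*} [Field K] {W : Type*} [AddCommGroup W] [Module K W]

/-! ### §1 Tensor coordinates in a basis and the action of `GL(W)` -/

section Coord

variable {L : Type*} [Fintype L] [DecidableEq L] (f : Basis L K W) {r : ℕ}

/-- The empty index family of the (absent) covector slots. [folklore] -/
def noIdx : Fin 0 → L := fun i => Fin.elim0 i

omit [Fintype L] [DecidableEq L] in
/-- Any `Fin 0`-family of letters is `noIdx`. [folklore] -/
theorem eq_noIdx (γ : Fin 0 → L) : γ = noIdx := funext fun i => Fin.elim0 i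

/-- The tensor basis vector `(⊗_q f (w q)) ⊗ ()` of `T^{r,0}_K W`. [folklore] -/
def tmon (w : Fin r → L) : hodgeTensorSpaceOver K W r 0 := hodgeTensorBasis f r 0 (w, noIdx)

/-- The coordinate functional of `T^{r,0}_K W` along `tmon f w`. [folklore] -/
def tcoordL (w : Fin r → L) : hodgeTensorSpaceOver K W r 0 →ₗ[K] K := (hodgeTensorBasis f r 0).coord (w, noIdx)

/-- The coordinate of `x ∈ T^{r,0}_K W` along `tmon f w`. [folklore] -/
def tcoord (x : hodgeTensorSpaceOver K W r 0) (w : Fin r → L) : K := tcoordL f w x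

/-- Unfolding: `tcoord f x w` is the `(w, ())`-coordinate in the tensor basis. [folklore] -/
theorem tcoord_eq_repr (x : hodgeTensorSpaceOver K W r 0) (w : Fin r → L) :
    tcoord f x w = (hodgeTensorBasis f r 0).repr x (w, noIdx) := rfl

/-- `tcoord` of a sum of scaled tensors. [folklore] -/
theorem tcoord_sum_smul {ι : Type*} (s : Finset ι) (c : ι → K) (x : ι → hodgeTensorSpaceOver K W r 0)
    (w : Fin r → L) : tcoord f (∑ i ∈ s, c i • x i) w = ∑ i ∈ s, c i * tcoord f (x i) w := by
  simp only [tcoord, map_sum, map_smul, smul_eq_mul]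

/-- `tcoord` is homogeneous in the tensor. [folklore] -/
theorem tcoord_smul (c : K) (x : hodgeTensorSpaceOver K W r 0) (w : Fin r → L) :
    tcoord f (c • x) w = c * tcoord f x w := by
  simp only [tcoord, map_smul, smul_eq_mul]

/-- Coordinates of a basis tensor. [folklore] -/
theorem tcoord_tmon (w w' : Fin r → L) : tcoord f (tmon f w) w' = if w' = w then 1 else 0 := by
  rw [tcoord_eq_repr, tmon, Basis.repr_self, Finsupp.single_apply]
  by_cases h : w' = w
  · subst h; simp
  · rw [if_neg h, if_neg fun h' => h (Prod.ext_iff.mp h').1.symm]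

/-- **Expansion in the tensor basis**: `x = Σ_w tcoord f x w • tmon f w`. [folklore] -/
theorem sum_tcoord_smul_tmon (x : hodgeTensorSpaceOver K W r 0) : ∑ w, tcoord f x w • tmon f w = x := by
  conv_rhs => rw [← (hodgeTensorBasis f r 0).sum_repr x]
  rw [Fintype.sum_prod_type]
  refine Finset.sum_congr rfl fun w _ => ?_
  rw [Fintype.sum_eq_single noIdx fun γ hγ => absurd (eq_noIdx γ) hγ]
  rfl

/-- Two tensors with the same coordinates are equal. [folklore] -/
theorem ext_tcoord {x y : hodgeTensorSpaceOver K W r 0} (h : ∀ w, tcoord f x w = tcoord f y w) : x = y := by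
  rw [← sum_tcoord_smul_tmon f x, ← sum_tcoord_smul_tmon f y]
  exact Finset.sum_congr rfl fun w _ => by rw [h w]

/-- Multilinear expansion of `⊗_q (Σ_a N a (w q) • f a) ⊗ ()`. [folklore] -/
theorem tprod_sum_smul_tmul (N : Matrix L L K) (w : Fin r → L) :
    (PiTensorProduct.tprod K fun q => ∑ a, N a (w q) • f a) ⊗ₜ[K]
        (PiTensorProduct.tprod K fun l : Fin 0 => f.dualBasis (noIdx l)) =
      ∑ w' : Fin r → L, (∏ q, N (w' q) (w q)) • tmon f w' := by
  have hsum := (PiTensorProduct.tprod K (s := fun _ : Fin r => W)).map_sum (fun q a => N a (w q) • f a)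
  rw [hsum, TensorProduct.sum_tmul]
  refine Finset.sum_congr rfl fun w' _ => ?_
  rw [MultilinearMap.map_smul_univ, ← TensorProduct.smul_tmul', tmon, hodgeTensorBasis_apply]

/-- **The action of `γ ∈ GL(W)` on a basis tensor**, through the matrix of `γ` in `f`. [folklore] -/
theorem tensorSpaceActOver_tmon (γ : W ≃ₗ[K] W) (w : Fin r → L) :
    tensorSpaceActOver γ (tmon f w) = ∑ w' : Fin r → L, (∏ q, LinearMap.toMatrix f f (γ : W →ₗ[K] W) (w' q) (w q)) • tmon f w' := by
  rw [tmon, hodgeTensorBasis_apply, tensorSpaceActOver_tmul_tprod,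
    eq_noIdx (fun i => f.dualBasis (noIdx i) ∘ₗ (γ.symm : W →ₗ[K] W) : Fin 0 → Module.Dual K W)]
  have hcol : ∀ q, γ (f (w q)) = ∑ a, LinearMap.toMatrix f f (γ : W →ₗ[K] W) a (w q) • f a := by
    intro q
    have h := Matrix.toLin_self f f (LinearMap.toMatrix f f (γ : W →ₗ[K] W)) (w q)
    rwa [Matrix.toLin_toMatrix] at h
  simp_rw [hcol]
  rw [← tprod_sum_smul_tmul f]
  congr 1
  exact congrArg _ (funext fun i => Fin.elim0 i)

/-- **The action in coordinates**: `tcoord f (γ x) w' = Σ_w (Π_q [γ]_f (w' q) (w q)) tcoord f x w`. [folklore] -/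
theorem tcoord_tensorSpaceActOver (γ : W ≃ₗ[K] W) (x : hodgeTensorSpaceOver K W r 0) (w' : Fin r → L) :
    tcoord f (tensorSpaceActOver γ x) w' = ∑ w, (∏ q, LinearMap.toMatrix f f (γ : W →ₗ[K] W) (w' q) (w q)) * tcoord f x w := by
  have hexp : tensorSpaceActOver γ x =
      ∑ w'', (∑ w, (∏ q, LinearMap.toMatrix f f (γ : W →ₗ[K] W) (w'' q) (w q)) * tcoord f x w) • tmon f w'' := by
    conv_lhs => rw [← sum_tcoord_smul_tmon f x, map_sum]
    simp_rw [map_smul, tensorSpaceActOver_tmon, Finset.smul_sum, smul_smul]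
    rw [Finset.sum_comm]
    refine Finset.sum_congr rfl fun w'' _ => ?_
    rw [Finset.sum_smul]
    exact Finset.sum_congr rfl fun w _ => by rw [mul_comm]
  rw [hexp, tcoord_sum_smul]
  simp_rw [tcoord_tmon, mul_ite, mul_one, mul_zero]
  rw [Finset.sum_ite_eq Finset.univ w', if_pos (Finset.mem_univ _)]

end Coord

/-! ### §2 Block elements of the deck-unitary group and their matrices -/

section Block

variable [CharZero K] [FiniteDimensional K W] {σ : W →ₗ[K] W} {ζ : K} {p h : ℕ} {B : LinearMap.BilinForm K W}
variable (hσ : σ ^ p = 1) (hζ : IsPrimitiveRoot ζ p) (hp : 0 < p) (hph : p = 2 * h + 1)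
  (hB : ∀ x y, B (σ x) (σ y) = B x y) (hBn : B.Nondegenerate) (hBs : ∀ x y, B x y = B y x)
  {n : ℕ} (hn : ∀ j, 1 ≤ j → j < p → Module.finrank K ↥(E σ ζ p j) = n)
  {x₀ : W} (hx₀ : x₀ ≠ 0) (hx₀E : x₀ ∈ E σ ζ p 0) (hgen : ∀ x ∈ E σ ζ p 0, ∃ c : K, x = c • x₀)

/-- The automorphism of `E_{i+1}` with matrix `g` in the basis `bE i`. [folklore] -/
def blockAut (i : Fin h) (g : GL (Fin n) K) : ↥(E σ ζ p (i.val + 1)) ≃ₗ[K] ↥(E σ ζ p (i.val + 1)) :=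
  LinearEquiv.ofLinear (Matrix.toLin (bE hph hn i) (bE hph hn i) (g : Matrix (Fin n) (Fin n) K))
    (Matrix.toLin (bE hph hn i) (bE hph hn i) ((g⁻¹ : GL (Fin n) K) : Matrix (Fin n) (Fin n) K))
    (by rw [← Matrix.toLin_mul, ← Units.val_mul, mul_inv_cancel, Units.val_one, Matrix.toLin_one])
    (by rw [← Matrix.toLin_mul, ← Units.val_mul, inv_mul_cancel, Units.val_one, Matrix.toLin_one])

omit [CharZero K] in
/-- `blockAut i g` on the basis `bE i`. [folklore] -/
theorem blockAut_apply_bE (i : Fin h) (g : GL (Fin n) K) (a : Fin n) :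
    blockAut hph hn i g (bE hph hn i a) = ∑ a', (g : Matrix (Fin n) (Fin n) K) a' a • bE hph hn i a' := by
  change Matrix.toLin (bE hph hn i) (bE hph hn i) (g : Matrix (Fin n) (Fin n) K) (bE hph hn i a) = _
  rw [Matrix.toLin_self]

omit [CharZero K] in
/-- `(blockAut i g)⁻¹` on the basis `bE i`. [folklore] -/
theorem blockAut_symm_apply_bE (i : Fin h) (g : GL (Fin n) K) (a : Fin n) :
    (blockAut hph hn i g).symm (bE hph hn i a) =
      ∑ a', ((g⁻¹ : GL (Fin n) K) : Matrix (Fin n) (Fin n) K) a' a • bE hph hn i a' := by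
  change Matrix.toLin (bE hph hn i) (bE hph hn i) ((g⁻¹ : GL (Fin n) K) : Matrix (Fin n) (Fin n) K) (bE hph hn i a) = _
  rw [Matrix.toLin_self]

include hph in
omit [CharZero K] [FiniteDimensional K W] in
/-- Index facts for the block `j = i + 1`, `i < h`, `p = 2h + 1`. [folklore] -/
theorem blockFacts (i : Fin h) :
    i.val + 1 < p ∧ p - (i.val + 1) < p ∧ p ∣ i.val + 1 + (p - (i.val + 1)) ∧ i.val + 1 ≠ p - (i.val + 1) ∧
      0 < i.val + 1 ∧ 0 < p - (i.val + 1) := by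
  have hi := i.2
  refine ⟨by omega, by omega, ?_, by omega, by omega, by omega⟩
  rw [Nat.add_sub_cancel' (by omega)]

/-- **The block element** `glElem i g ∈ GL(W)`: `g` on `E_{i+1}`, `(g⁻¹)^∨` on `E_{p-(i+1)}`, identity elsewhere.
[folklore] -/
def glElem (i : Fin h) (g : GL (Fin n) K) : W ≃ₗ[K] W :=
  ext hσ hζ hp hB hBn (blockFacts hph i).1 (blockFacts hph i).2.1 (blockFacts hph i).2.2.1 (blockFacts hph i).2.2.2.1
    (blockAut hph hn i g)

include hBs in
/-- **`glElem i g ∈ U⁰(K)`.** [folklore] -/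
theorem glElem_mem_centIso (i : Fin h) (g : GL (Fin n) K) : glElem hσ hζ hp hph hB hBn hn i g ∈ centIso σ B :=
  ext_mem_centIso hσ hζ hp hB hBn _ _ _ _ (blockFacts hph i).2.2.2.2.1 (blockFacts hph i).2.2.2.2.2 hBs _

/-- `glElem i g` on the vector letters of colour `i`. [folklore] -/
theorem glElem_vec (i : Fin h) (g : GL (Fin n) K) (a : Fin n) :
    glElem hσ hζ hp hph hB hBn hn i g (adaptedBasis hσ hζ hp hph hB hBn hn hx₀ hx₀E hgen (some (i, false, a))) =
      ∑ a', (g : Matrix (Fin n) (Fin n) K) a' a • adaptedBasis hσ hζ hp hph hB hBn hn hx₀ hx₀E hgen (some (i, false, a')) := by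
  simp_rw [adaptedBasis_vec]
  rw [glElem, ext_apply_of_mem, blockAut_apply_bE, Submodule.coe_sum]
  simp_rw [Submodule.coe_smul]

/-- `glElem i g` on the covector letters of colour `i`: the contragredient `(g⁻¹)ᵀ` in the dual basis. [folklore] -/
theorem glElem_cov (i : Fin h) (g : GL (Fin n) K) (a : Fin n) :
    glElem hσ hζ hp hph hB hBn hn i g (adaptedBasis hσ hζ hp hph hB hBn hn hx₀ hx₀E hgen (some (i, true, a))) =
      ∑ a', ((g⁻¹ : GL (Fin n) K) : Matrix (Fin n) (Fin n) K) a a' •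
        adaptedBasis hσ hζ hp hph hB hBn hn hx₀ hx₀E hgen (some (i, true, a')) := by
  obtain ⟨hj, hj', hjj, hne, hj0, hj0'⟩ := blockFacts (p := p) hph i
  simp_rw [adaptedBasis_cov]
  rw [glElem]
  change extLin hσ hζ hp hB hBn hj hj' hjj (blockAut hph hn i g) _ = _
  rw [extLin_apply_of_mem' hσ hζ hp hB hBn hj hj' hjj hne]
  -- both sides lie in `E_{p-(i+1)}` and have the same pairings against `E_{i+1}`
  refine eq_of_forall_apply_eigenblock hσ hζ hp hB hBn hj hjj (Submodule.coe_mem _)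
    (Submodule.sum_mem _ fun a' _ => Submodule.smul_mem _ _ (Submodule.coe_mem _)) fun x hx => ?_
  have key : ∀ c : Fin n,
      B (bE hph hn i c : W) (contra hσ hζ hp hB hBn hj hj' hjj (blockAut hph hn i g) (bD hσ hζ hp hph hB hBn hn i a) : W) =
        B (bE hph hn i c : W) (∑ a', ((g⁻¹ : GL (Fin n) K) : Matrix (Fin n) (Fin n) K) a a' •
          (bD hσ hζ hp hph hB hBn hn i a' : W)) := by
    intro c
    rw [apply_contra, blockAut_symm_apply_bE, Submodule.coe_sum, map_sum, LinearMap.sum_apply, map_sum]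
    simp only [Submodule.coe_smul, map_smul, LinearMap.smul_apply, smul_eq_mul, apply_bE_bD]
    simp only [mul_ite, mul_one, mul_zero]
    rw [Finset.sum_ite_eq' Finset.univ a, if_pos (Finset.mem_univ _), Finset.sum_ite_eq Finset.univ c,
      if_pos (Finset.mem_univ _)]
  have hxexp : x = ∑ c, (bE hph hn i).repr ⟨x, hx⟩ c • (bE hph hn i c : W) := by
    have h := congrArg Subtype.val ((bE hph hn i).sum_repr ⟨x, hx⟩)
    rw [Submodule.coe_sum] at h
    simp only [Submodule.coe_smul] at h
    exact h.symm
  rw [hxexp, map_sum, LinearMap.sum_apply, LinearMap.sum_apply]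
  refine Finset.sum_congr rfl fun c _ => ?_
  rw [map_smul, LinearMap.smul_apply, LinearMap.smul_apply, key]

/-- `glElem i g` fixes `x₀`. [folklore] -/
theorem glElem_none (i : Fin h) (g : GL (Fin n) K) :
    glElem hσ hζ hp hph hB hBn hn i g (adaptedBasis hσ hζ hp hph hB hBn hn hx₀ hx₀E hgen none) =
      adaptedBasis hσ hζ hp hph hB hBn hn hx₀ hx₀E hgen none := by
  obtain ⟨hj, hj', hjj, hne, hj0, hj0'⟩ := blockFacts (p := p) hph i
  rw [adaptedBasis_none, glElem]
  change extLin hσ hζ hp hB hBn hj hj' hjj (blockAut hph hn i g) _ = _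
  exact extLin_apply_of_mem_other hσ hζ hp hB hBn hj hj' hjj _ hp (by omega) (by omega) ⟨x₀, hx₀E⟩

/-- `glElem i g` fixes the letters of the other colours. [folklore] -/
theorem glElem_other (i : Fin h) (g : GL (Fin n) K) {i' : Fin h} (hi' : i' ≠ i) (b : Bool) (a : Fin n) :
    glElem hσ hζ hp hph hB hBn hn i g (adaptedBasis hσ hζ hp hph hB hBn hn hx₀ hx₀E hgen (some (i', b, a))) =
      adaptedBasis hσ hζ hp hph hB hBn hn hx₀ hx₀E hgen (some (i', b, a)) := by
  obtain ⟨hj, hj', hjj, hne, hj0, hj0'⟩ := blockFacts (p := p) hph i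
  have hii : i'.val ≠ i.val := fun e => hi' (Fin.ext e)
  have hi2 := i.2
  have hi'2 := i'.2
  rw [glElem]
  change extLin hσ hζ hp hB hBn hj hj' hjj (blockAut hph hn i g) _ = _
  cases b
  · rw [adaptedBasis_vec]
    exact extLin_apply_of_mem_other hσ hζ hp hB hBn hj hj' hjj _ (by omega) (by omega) (by omega) (bE hph hn i' a)
  · rw [adaptedBasis_cov]
    exact extLin_apply_of_mem_other hσ hζ hp hB hBn hj hj' hjj _ (by omega) (by omega) (by omega)
      (bD hσ hζ hp hph hB hBn hn i' a)

end Block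

end Summit.HodgeConjecture.HodgeConjecture.Theorems.CyclicUnitaryPowersBlockAction

end
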